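import Summits.HodgeConjecture.HodgeConjecture.Theorems.F0P2oU1DisjointOfTower          -- ★ p828521 (B-p18 (g28)): the (1)–(5) ⟹ ‹U1-DISJOINT› assembly
import Summits.HodgeConjecture.HodgeConjecture.Theorems.F0P2oU1DichotomyOfDisjoint         -- ★ p828329 (A-p12 (g16)): ‹U1-DISJOINT› ⟹ the U1 letter
import Summits.HodgeConjecture.HodgeConjecture.Theorems.F0P2oThetaCenterCharGlobalise      -- ★ p829029 (B-p18 (g28)): road (T) step (1) `exists_chi_isThetaCenterChar`
import Summits.HodgeConjecture.HodgeConjecture.Theorems.F0P2oXThetaLineRigidity            -- ★ p829024 (F0P2-p05 (g0)): road (T) step (5) `exists_mul_conj_eq_ratio_of_areIsomorphicRep_xThetaCM`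
import HarnessLib

/-!
# Crux `H413`, programme P2 — road (T) «UP THE TOWER»: THE U1 LETTER FROM THE TOWER (closer, by name)

Cell hodgecm-mathlib (D-0151), FLOOR 0, crux H413 = stmt-HodgeConjecture-24833; lead B-p18 (g28).  The print letter U1 ★ `GelbartRogawski1991.u1ThetaDichotomy_nonsplit`
([HarrisKudlaSweet1996 Cor. 4.4 (m = n = 1); Rogawski1992 Prop. 3.4]; INVENTORY row III-43; the `stub_U1_letter` of `Cruxes/H413/Lines/F0_P2GR91NJacquetK1.lean` v3c and of
`Cruxes/H413/Lines/F0_P2GR91NJacquet.lean` v1.2) is DERIVED BY NAME from the road-(T) pieces: ★ step (6) `F0P2oU1DichotomyOfDisjoint.u1ThetaDichotomy_nonsplit_of_disjoint` (A-p12)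
∘ ★ assembly `F0P2oU1DisjointOfTower.u1Disjoint_of_letters` (B-p18) fed with ★ step (1) `F0P2oThetaCenterCharGlobalise.exists_chi_isThetaCenterChar` (B-p18), step (4) (binder `h4`,
F0P2-p02 (g6) `principalSeries_uniqueSub` over the N1 letter — folded by name in §2 when ★) and ★ step (5) `F0P2oXThetaLineRigidity.exists_mul_conj_eq_ratio_of_areIsomorphicRep_xThetaCM` (p05).
CONDITIONAL on the N3 letter `hN3` and on the sub-uniqueness binder `h4` only; THEOREMS ONLY.  HC_CM is proved only modulo the printed citations until rung 0 closes.

## References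
* [HarrisKudlaSweet1996] JAMS 9: Cor. 4.4 p. 962.  [GelbartRogawski1991] Invent. Math. 105: Remark p. 466; §3.2 (3.2.1)–(3.2.2) p. 457; §5.2 p. 467.
* [Rogawski1990] Ann. of Math. Stud. 123: §12.1 p. 172, §12.2 pp. 173–174.  [MoeglinVignerasWaldspurger1987] Chap. 3 §IV.4.
-/

set_option autoImplicit false
-- the mandated namespace has the single-problem summit's repeated segment (`HodgeConjecture.HodgeConjecture`)
set_option linter.dupNamespace false

noncomputable section

open NumberField IsDedekindDomain MeasureTheory
open scoped Matrix

open Literature.NumberTheory Literature.NumberTheory.Automorphic Literature.NumberTheory.Automorphic.UnitaryGroup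
open Literature.NumberTheory.Automorphic.IdeleClassGroup
open Literature.NumberTheory.Automorphic.Liu2021 Literature.NumberTheory.Automorphic.Liu2021.Def411WeilCarriers
open Literature.NumberTheory.GaloisRepresentations
open Literature.NumberTheory.Rogawski1990
open Literature.NumberTheory.GelbartRogawski1991

namespace Summit.HodgeConjecture.HodgeConjecture.Cruxes.H413.F0P2oU1LetterOfTower

/-! ## §1 The U1 letter modulo N3 and the sub-uniqueness binder (4) -/

set_option synthInstance.maxHeartbeats 400000 in
set_option maxHeartbeats 8000000 in
/-- **U1 FROM THE TOWER, modulo N3 and step (4).**  `u1ThetaDichotomy_nonsplit` ⟸ (6) ★ ∘ assembly ★ ∘ ((1) ★, (4) = `h4`, (5) ★).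
[cite: HarrisKudlaSweet1996, Cor. 4.4 p. 962] [cite: GelbartRogawski1991, Remark p. 466] [cite: Rogawski1990, §12.2 pp. 173–174] -/
theorem u1ThetaDichotomy_nonsplit_of_uniqueSub
    (hN3 : Literature.NumberTheory.GelbartRogawski1991.thetaType_nonsplit_jacquetModule)
    (h4 : ∀ (L : Type) [Field L] [NumberField L] [IsCMField L] (v : HeightOneSpectrum (𝓞 ↥(maximalRealSubfield L))),
      (∀ w : PlacesOver L v, IsCMField.complexConj L • w.1 = w.1) →
      ∀ (χ₁ : (UnitaryGroup.LocalRing L v)ˣ →* ℂˣ) (χ₂ : ↥(normOneUnits (conjLocal L (IsCMField.complexConj L) v)) →* ℂˣ),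
        (Continuous fun x => ((χ₁ x : ℂˣ) : ℂ)) → (Continuous fun x => ((χ₂ x : ℂˣ) : ℂ)) →
        cmTorusCharPair L v χ₁ χ₂ ≠ cmWeylTorusCharPair L v χ₁ χ₂ →
        ∀ {V₁ V₂ : Type} [AddCommGroup V₁] [Module ℂ V₁] [AddCommGroup V₂] [Module ℂ V₂]
          (π₁ : Representation ℂ (Gqs L v) V₁) (π₂ : Representation ℂ (Gqs L v) V₂),
          π₁.IsIrreducible → π₁.IsSmooth → π₂.IsIrreducible → π₂.IsSmooth →
          haveI := locallyCompactSpace_cmBorelU L 3 v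
          ∀ (Φ₁ : π₁.IntertwiningMap (cmPrincipalSeries L 3 v (cmTorusCharPair L v χ₁ χ₂)))
            (Φ₂ : π₂.IntertwiningMap (cmPrincipalSeries L 3 v (cmTorusCharPair L v χ₁ χ₂))),
            Φ₁ ≠ 0 → Φ₂ ≠ 0 → AreIsomorphicRep π₁ π₂)
    : Literature.NumberTheory.GelbartRogawski1991.u1ThetaDichotomy_nonsplit :=
  F0P2oU1DichotomyOfDisjoint.u1ThetaDichotomy_nonsplit_of_disjoint
    (F0P2oU1DisjointOfTower.u1Disjoint_of_letters hN3 F0P2oThetaCenterCharGlobalise.exists_chi_isThetaCenterChar h4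
      F0P2oXThetaLineRigidity.exists_mul_conj_eq_ratio_of_areIsomorphicRep_xThetaCM)

end Summit.HodgeConjecture.HodgeConjecture.Cruxes.H413.F0P2oU1LetterOfTower

end
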